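import Literature.NumberTheory.EllipticCurves.ModularSymbolsParabolicCohomologyProofs
import HarnessLib

/-!
# Crux Kan⁺ `ThetaLayerLambdaCongruenceAtTwo` (stmt-BirchSwinnertonDyer-20688), SD floor, brick S1 —
# parabolic–elliptic cocycles of `Γ₀(N)` over an arbitrary field, I: the operators on `K^X`
# (width seat bsd-wall-rtt-p3-w4 g6; `--supports stmt-BirchSwinnertonDyer-20688`; proofs + internal carriers only,
# no named fact, no `sorry`; BSD is not proved by any of this)

`ModularSymbolsParabolicCohomologyProofs` proves Shimura's count
`dim_ℝ H¹_P(Γ₀(N), ℝ) ≤ 2 dim_ℂ S₂(Γ₀(N))` (`ParabolicCount.six_mul_finrank_parabolicCocycles_le`) by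
Shapiro's lemma and linear algebra in the permutation module `ℝ^X`, `X = SL(2, ℤ)/Γ₀(N)`. Two steps of
that proof use characteristic `0`: the rank identities `2 rk(1 + S^*) = μ + ε₂` and
`3 rk(1 + U + U²) = μ + 2ε₃` (`U = (ST)^*`) are trace computations which divide by `2` and `3`, and
indeed FAIL over a field of characteristic `2` or `3` — there `Hom(Γ₀(N), K)` is larger than `2g + ε_∞ - 1`
by the classes of the elliptic generators of order `2` (resp. `3`) of `Γ₀(N)/{±1}`.

This file and its sequels (`…SdTorsionOrbitCount`, `…SdTorsionShapiroCount`)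
redo the count over an ARBITRARY field `K` for homomorphisms `u : Γ₀(N) → K` killing the parabolic AND THE
ELLIPTIC elements of `Γ₀(N)` (= `Hom(π₁(X₀(N)(ℂ)), K) = H¹(X₀(N)(ℂ), K)`): the elliptic condition forces the
Shapiro lift `E_u(S)` to vanish on the `S`-fixed cosets and `E_u(ST)` on the `ST`-fixed cosets, and the two
trace identities are replaced by orbit counting, valid in every characteristic. Here: the `K`-versions
`coperm`, `relS`, `relST`, `cuspSum` of the `ℝ`-operators of `ParabolicCount` (same names, namespace
`ParabolicCountK`), the ELLIPTIC-REFINED kernels `kerS` (`(1 + S^*)a = 0` and `a = 0` on the `S`-fixed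
cosets) and `kerST` (`(1 + U + U²)b = 0` and `b = 0` on the `ST`-fixed cosets), the cusp sums (onto
`K^{cusps}`, `cuspSum_surjective`), and `kerST + ker(cusp sums)` has codimension `≤ 1`
(`card_le_finrank_kerST_sup_add_one`, as over `ℝ`). The field-free transfer elements `ParabolicCount.sec`,
`ParabolicCount.liftElem` of the `ℝ` file are reused by the sequels, not redefined.

Purpose (tree): brick S1 of the sign-free mod-`2` Poincaré-duality architecture for the Hecke self-duality
of `J₀(N)[2]` (`heckeSelfDual_torsionBy_J0` as consumed at `ℓ = 2`), whose first input is the `ℓ`-torsion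
Eichler–Shimura count `dim_{𝔽_ℓ} Hom(Γ₀(N)/⟨±1, elliptic, parabolic⟩, 𝔽_ℓ) ≤ 2g`.

## References
* G. Shimura, *Introduction to the arithmetic theory of automorphic functions* (1971), §8.1–8.2
  (Prop. 8.1, (8.2.24): the Euler-characteristic count, here organised group-theoretically) [ShimuraIATAF1971].
* G. Wiese, Multiplicities of Galois representations of weight one, ANT 1 (2007), §2–3 (parabolic group
  cohomology of `Γ₀(N)` over `𝔽_p` versus the cohomology of the modular curve) [Wiese2007Multiplicities].
* J. E. Cremona, *Algorithms for modular elliptic curves* (1997), §2.1–2.2 (the relation operators `1 + S`,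
  `1 + TS + (TS)²`, cusps as `⟨T⟩`-orbits) [CremonaAlgorithms1997].
* K. S. Brown, *Cohomology of groups* (1982), III.6 (Shapiro's lemma) [Brown1982CohomologyGroups].
-/


-- justification: the `Summit.BirchSwinnertonDyer.BirchSwinnertonDyer.…` path repeats a component (route-file convention)
set_option linter.dupNamespace false
set_option autoImplicit false

noncomputable section

open scoped MatrixGroups ModularForm

open CongruenceSubgroup Matrix.SpecialLinearGroup ModularGroup

open Literature.NumberTheory.EllipticCurves.ModularForms

namespace Summit.BirchSwinnertonDyer.BirchSwinnertonDyer.Theorems.SdTorsion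

namespace ParabolicCountK

open _root_.Module _root_.LinearMap
open scoped Classical

variable {K : Type*} [Field K] {N : ℕ}


/-! ### The permutation representation `K^X`, `X = SL(2, ℤ)/Γ₀(N)` -/

/-- The permutation action of `g ∈ SL(2, ℤ)` on `K^X`: `(g^* f)(x) = f(g x)` (the `K`-version of
`ParabolicCount.coperm`). [folklore] -/
def coperm (g : SL(2, ℤ)) : (Gamma0Coset N → K) →ₗ[K] (Gamma0Coset N → K) :=
  LinearMap.funLeft K K (g • ·)

/-- Unfolding `coperm`. [folklore] -/
@[simp] theorem coperm_apply (g : SL(2, ℤ)) (f : Gamma0Coset N → K) (x : Gamma0Coset N) :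
    coperm g f x = f (g • x) := rfl

/-- `(gh)^* = h^* ∘ g^*`. [folklore] -/
theorem coperm_mul (g h : SL(2, ℤ)) :
    coperm (K := K) (N := N) (g * h) = coperm h ∘ₗ coperm g := by
  apply LinearMap.ext
  intro f
  funext x
  simp [mul_smul]

/-- `1^* = 1`. [folklore] -/
theorem coperm_one : coperm (K := K) (N := N) 1 = LinearMap.id := by
  apply LinearMap.ext
  intro f
  funext x
  simp

/-- `(-g)^* = g^*` (`-1 ∈ Γ₀(N)` acts trivially on the cosets). [folklore] -/
theorem coperm_neg (g : SL(2, ℤ)) : coperm (K := K) (N := N) (-g) = coperm g := by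
  apply LinearMap.ext
  intro f
  funext x
  simp [neg_smul_coset]

/-- `(-1)^* = 1`. [folklore] -/
theorem coperm_neg_one : coperm (K := K) (N := N) (-1) = LinearMap.id := by
  rw [coperm_neg, coperm_one]

/-- `g^* ∘ (g⁻¹)^* = 1`. [folklore] -/
theorem coperm_comp_coperm_inv (g : SL(2, ℤ)) :
    coperm (K := K) (N := N) g ∘ₗ coperm g⁻¹ = LinearMap.id := by
  rw [← coperm_mul, inv_mul_cancel, coperm_one]

/-- `(g⁻¹)^* ∘ g^* = 1`. [folklore] -/
theorem coperm_inv_comp_coperm (g : SL(2, ℤ)) :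
    coperm (K := K) (N := N) g⁻¹ ∘ₗ coperm g = LinearMap.id := by
  rw [← coperm_mul, mul_inv_cancel, coperm_one]

/-- `g^* (g⁻¹)^* f = f`. [folklore] -/
@[simp] theorem coperm_coperm_inv (g : SL(2, ℤ)) (f : Gamma0Coset N → K) :
    coperm g (coperm g⁻¹ f) = f := by
  have := congrArg (fun φ ↦ φ f) (coperm_comp_coperm_inv (K := K) (N := N) g)
  simpa using this

/-- `(g⁻¹)^* g^* f = f`. [folklore] -/
@[simp] theorem coperm_inv_coperm (g : SL(2, ℤ)) (f : Gamma0Coset N → K) :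
    coperm g⁻¹ (coperm g f) = f := by
  have := congrArg (fun φ ↦ φ f) (coperm_inv_comp_coperm (K := K) (N := N) g)
  simpa using this

/-- `g^* e_x = e_{g⁻¹x}`. [folklore] -/
theorem coperm_single (g : SL(2, ℤ)) (x : Gamma0Coset N) (a : K) :
    coperm g (Pi.single x a) = Pi.single (g⁻¹ • x) a := by
  funext y
  simp only [coperm_apply, Pi.single_apply, eq_inv_smul_iff]

/-- `((ST)^*)³ = 1`. [folklore] -/
theorem coperm_ST_comp_ST_comp_ST :
    coperm (K := K) (N := N) (S * T) ∘ₗ (coperm (S * T) ∘ₗ coperm (S * T)) = LinearMap.id := by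
  rw [← coperm_mul, ← coperm_mul, ParabolicCount.ST_pow_three_eq, coperm_neg_one]

omit [Field K] in
/-- `S(Sx) = x` on cosets (`S² = -1 ∈ Γ₀(N)`). [folklore] -/
theorem S_smul_S_smul (x : Gamma0Coset N) : S • S • x = x := by
  rw [← mul_smul, S_mul_S_eq_neg_one, neg_one_smul_coset]

omit [Field K] in
/-- `(ST)³x = x` on cosets (`(ST)³ = -1 ∈ Γ₀(N)`). [folklore] -/
theorem ST_smul_ST_smul_ST_smul (x : Gamma0Coset N) : (S * T) • (S * T) • (S * T) • x = x := by
  rw [← mul_smul, ← mul_smul, ParabolicCount.ST_pow_three_eq, neg_one_smul_coset]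

variable (K N)

/-- The operator `1 + S^*` on `K^X`. [folklore] -/
def relS : (Gamma0Coset N → K) →ₗ[K] (Gamma0Coset N → K) := LinearMap.id + coperm S

/-- The operator `1 + (ST)^* + (ST)^{*2}` on `K^X`. [folklore] -/
def relST : (Gamma0Coset N → K) →ₗ[K] (Gamma0Coset N → K) :=
  LinearMap.id + coperm (S * T) + coperm (S * T) ∘ₗ coperm (S * T)

/-- Unfolding `relS` at a point: `((1 + S^*)a)(x) = a(x) + a(Sx)`. [folklore] -/
@[simp] theorem relS_apply (a : Gamma0Coset N → K) (x : Gamma0Coset N) :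
    relS K N a x = a x + a (S • x) := rfl

/-- Unfolding `relST` at a point: `((1 + U + U²)b)(x) = b(x) + b(STx) + b((ST)²x)`. [folklore] -/
@[simp] theorem relST_apply (b : Gamma0Coset N → K) (x : Gamma0Coset N) :
    relST K N b x = b x + b ((S * T) • x) + b ((S * T) • (S * T) • x) := rfl

/-- **The elliptic-refined kernel of `1 + S^*`**: functions `a ∈ K^X` with `(1 + S^*)a = 0` which moreover
VANISH ON THE `S`-FIXED COSETS (over `ℝ` the second condition follows from the first, `2a(x) = 0`; in
characteristic `2` it is exactly the information carried by "`u` kills the elliptic elements of order `4`").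
[folklore] -/
def kerS : Submodule K (Gamma0Coset N → K) where
  carrier := {a | relS K N a = 0 ∧ ∀ x : Gamma0Coset N, S • x = x → a x = 0}
  add_mem' := by
    rintro a b ⟨ha, ha'⟩ ⟨hb, hb'⟩
    refine ⟨by rw [map_add, ha, hb, add_zero], fun x hx ↦ ?_⟩
    simp [ha' x hx, hb' x hx]
  zero_mem' := ⟨map_zero _, fun _ _ ↦ rfl⟩
  smul_mem' := by
    rintro c a ⟨ha, ha'⟩
    refine ⟨by rw [map_smul, ha, smul_zero], fun x hx ↦ ?_⟩
    simp [ha' x hx]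

/-- **The elliptic-refined kernel of `1 + U + U²`** (`U = (ST)^*`): functions `b ∈ K^X` with
`(1 + U + U²)b = 0` which VANISH ON THE `ST`-FIXED COSETS (in characteristic `3` this is the information
"`u` kills the elliptic elements of order `3` and `6`"). [folklore] -/
def kerST : Submodule K (Gamma0Coset N → K) where
  carrier := {b | relST K N b = 0 ∧ ∀ x : Gamma0Coset N, (S * T) • x = x → b x = 0}
  add_mem' := by
    rintro a b ⟨ha, ha'⟩ ⟨hb, hb'⟩
    refine ⟨by rw [map_add, ha, hb, add_zero], fun x hx ↦ ?_⟩
    simp [ha' x hx, hb' x hx]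
  zero_mem' := ⟨map_zero _, fun _ _ ↦ rfl⟩
  smul_mem' := by
    rintro c a ⟨ha, ha'⟩
    refine ⟨by rw [map_smul, ha, smul_zero], fun x hx ↦ ?_⟩
    simp [ha' x hx]

variable {K N}

/-- Membership in `kerS`. [folklore] -/
theorem mem_kerS_iff (a : Gamma0Coset N → K) :
    a ∈ kerS K N ↔ relS K N a = 0 ∧ ∀ x : Gamma0Coset N, S • x = x → a x = 0 := Iff.rfl

/-- Membership in `kerST`. [folklore] -/
theorem mem_kerST_iff (b : Gamma0Coset N → K) :
    b ∈ kerST K N ↔ relST K N b = 0 ∧ ∀ x : Gamma0Coset N, (S * T) • x = x → b x = 0 := Iff.rfl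

variable [NeZero N]

/-! ### The cusp sums: `b ↦ (∑_{x ∈ orbit} b(x))_{orbits of T}` -/

variable (K N) in
/-- The **cusp-sum map** `K^X → K^{cusps}`: `b ↦ (∑_{y ∈ ⟨T⟩x} b(y))_x`, indexed by the base points of the
`⟨T⟩`-orbits (one per cusp, `card_basePoints`); the `K`-version of `ParabolicCount.cuspSum`. [folklore] -/
def cuspSum : (Gamma0Coset N → K) →ₗ[K] ({x // x ∈ basePoints N} → K) where
  toFun b p := ∑ y ∈ orbitFin N p.1, b y
  map_add' b b' := by
    funext p
    simp [Finset.sum_add_distrib]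
  map_smul' c b := by
    funext p
    simp [Finset.mul_sum]

/-- Unfolding `cuspSum`. [folklore] -/
@[simp] theorem cuspSum_apply (b : Gamma0Coset N → K) (p : {x // x ∈ basePoints N}) :
    cuspSum K N b p = ∑ y ∈ orbitFin N p.1, b y := rfl

/-- The cusp sums are `T^*`-invariant. [folklore] -/
theorem cuspSum_coperm_T (b : Gamma0Coset N → K) : cuspSum K N (coperm T b) = cuspSum K N b := by
  funext p
  obtain ⟨p, hp⟩ := p
  simp only [cuspSum_apply, coperm_apply]
  rw [sum_orbitFin_eq, sum_orbitFin_eq]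
  simp_rw [smul_smul, ← pow_succ']
  have h := Finset.sum_range_succ' (fun i ↦ b (T ^ i • p)) (width N p)
  have h' := Finset.sum_range_succ (fun i ↦ b (T ^ i • p)) (width N p)
  rw [T_pow_width_smul] at h'
  simp only [pow_zero, one_smul] at h
  exact add_right_cancel (h.symm.trans h')

/-- The cusp-sum map is onto `K^{cusps}`. [folklore] -/
theorem cuspSum_surjective : Function.Surjective (cuspSum K N) := by
  intro h
  refine ⟨fun x ↦ if hx : x ∈ basePoints N then h ⟨x, hx⟩ else 0, ?_⟩
  funext p
  obtain ⟨p, hp⟩ := p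
  rw [cuspSum_apply, Finset.sum_eq_single p]
  · simp [hp]
  · intro y hy hyp
    rw [dif_neg]
    intro hyb
    have h1 : base N y = base N p := base_eq_of_mem N hy
    rw [(Finset.mem_filter.mp hyb).2, (Finset.mem_filter.mp hp).2] at h1
    exact hyp h1
  · intro hnp
    exact absurd (self_mem_orbitFin N p) hnp

/-- `rank(cusp sums) = ε_∞`. [folklore] -/
theorem finrank_range_cuspSum : finrank K (range (cuspSum K N)) = (basePoints N).card := by
  rw [LinearMap.range_eq_top.mpr cuspSum_surjective, finrank_top, finrank_fintype_fun_eq_card,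
    Fintype.card_coe]

/-- **`kerST + ker(cusp sums)` has codimension `≤ 1`**: it contains `Pf - f` for `P = (ST)^*` (as
`(1 + P + P²)(P - 1) = P³ - 1 = 0`, and `Pf - f` vanishes at the `ST`-fixed cosets) and for `P = T^*`,
hence for `P = g^*`, all `g ∈ ⟨ST, T⟩ = SL(2, ℤ)`, hence every `e_y - e_x` (`SL(2, ℤ)` is transitive on
`X`). [folklore] -/
theorem card_le_finrank_kerST_sup_add_one :
    Fintype.card (Gamma0Coset N) ≤ finrank K ↥(kerST K N ⊔ LinearMap.ker (cuspSum K N)) + 1 := by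
  set R : Submodule K (Gamma0Coset N → K) := kerST K N ⊔ LinearMap.ker (cuspSum K N) with hR
  have h3 := ST_smul_ST_smul_ST_smul (N := N)
  have hST : ∀ f : Gamma0Coset N → K, coperm (S * T) f - f ∈ R := fun f ↦ by
    refine Submodule.mem_sup_left ⟨?_, fun x hx ↦ ?_⟩
    · funext x
      simp only [relST_apply, Pi.sub_apply, coperm_apply, h3, Pi.zero_apply]
      ring
    · simp [hx]
  have hT : ∀ f : Gamma0Coset N → K, coperm T f - f ∈ R := fun f ↦ by
    refine Submodule.mem_sup_right ?_
    rw [LinearMap.mem_ker, map_sub, cuspSum_coperm_T, sub_self]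
  -- the subgroup of `g` with `g^* f - f ∈ R` for all `f`
  let G : Subgroup SL(2, ℤ) :=
    { carrier := {g | ∀ f : Gamma0Coset N → K, coperm g f - f ∈ R}
      mul_mem' := fun {a b} ha hb f ↦ by
        rw [coperm_mul, LinearMap.comp_apply, ← sub_add_sub_cancel _ (coperm a f) f]
        exact R.add_mem (hb _) (ha f)
      one_mem' := fun f ↦ by simp [coperm_one]
      inv_mem' := fun {a} ha f ↦ by
        have h := R.neg_mem (ha (coperm a⁻¹ f))
        rwa [coperm_coperm_inv, neg_sub] at h }
  have hTG : T ∈ G := hT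
  have hSG : S ∈ G := by
    have : S = S * T * T⁻¹ := by group
    rw [this]
    exact G.mul_mem hST (G.inv_mem hTG)
  have hG : G = ⊤ := by
    rw [eq_top_iff, ← SpecialLinearGroup.SL2Z_generators, Subgroup.closure_le]
    intro g hg
    rcases hg with rfl | rfl
    · exact hSG
    · exact hTG
  have hsingle : ∀ x y : Gamma0Coset N, Pi.single y (1 : K) - Pi.single x 1 ∈ R := by
    intro x y
    obtain ⟨g, hg⟩ : ∃ g : SL(2, ℤ), g⁻¹ • x = y := by
      induction x using QuotientGroup.induction_on with
      | H a =>
        induction y using QuotientGroup.induction_on with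
        | H b =>
          refine ⟨a * b⁻¹, ?_⟩
          rw [MulAction.Quotient.smul_mk, smul_eq_mul, mul_inv_rev, inv_inv, mul_assoc,
            inv_mul_cancel, mul_one]
    have h := (hG ▸ Subgroup.mem_top g : g ∈ G) (Pi.single x 1)
    rwa [coperm_single, hg] at h
  set x₀ : Gamma0Coset N := ((1 : SL(2, ℤ)) : Gamma0Coset N)
  set L : Submodule K (Gamma0Coset N → K) := Submodule.span K {Pi.single x₀ 1}
  have htop : (⊤ : Submodule K (Gamma0Coset N → K)) ≤ R ⊔ L := by
    rw [← (Pi.basisFun K _).span_eq, Submodule.span_le]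
    rintro _ ⟨x, rfl⟩
    rw [Pi.basisFun_apply]
    have : (Pi.single x (1 : K) : Gamma0Coset N → K) =
        (Pi.single x 1 - Pi.single x₀ 1) + Pi.single x₀ 1 := by abel
    rw [this]
    exact Submodule.add_mem_sup (hsingle x₀ x) (Submodule.subset_span rfl)
  have h1 : finrank K L ≤ 1 := by
    simpa using finrank_span_le_card ({Pi.single x₀ (1 : K)} : Set (Gamma0Coset N → K))
  have h2 := Submodule.finrank_mono htop
  rw [finrank_top, finrank_fintype_fun_eq_card] at h2
  have h4 := Submodule.finrank_add_le_finrank_add_finrank R L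
  omega

end ParabolicCountK

end Summit.BirchSwinnertonDyer.BirchSwinnertonDyer.Theorems.SdTorsion

end
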